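/-
Copyright (c) 2026 the pub-hodgecm-mathlib formalisation cell (harness21).  Prover seat hodgecm-mathlib-K2E5-p16 (g3) (cross-unit hand, §L of line `K2_E3_EllipticInputs`,
§L lead K2E3-p12 (g4), offer (SL-3) 2026-09-04T03:12:44Z «(LBU-2-iso-a)»): the NON-ZERO NILPOTENT ORBITS of `𝔲(1,1)` — the hyperbolic unitary plane.
-/
import Summits.HodgeConjecture.HodgeConjecture.Theorems.K2E3LieUnitaryDefs   -- ★ K2-defs1 (g2): `lieOfForm`, `mem_lieOfForm_iff`, `conj_mem_lieOfForm` (+ ★ `unitaryGroupOfForm`)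
import HarnessLib

/-!
# K2 ∕ E3 `K2_E3_EllipticInputs`, §L at `N = 2`, U-side — (LBU-2-iso-a) `K2E3U11RegularNilpotentOrbits`: THE NON-ZERO NILPOTENT `U(σ,J₀)`-ORBITS OF `𝔲(σ, J₀)`,
# `J₀ = !![0,1;1,0]` THE HYPERBOLIC (ISOTROPIC) HERMITIAN PLANE — normal form `u·(b E₁₂)·u⁻¹` (`σb = −b`), orbit parameter `b` modulo `N_{E∕F}(Eˣ)`

Cell `hodgecm-mathlib` (Track B «K2-LIT»), item h413 = `stmt-HodgeConjecture-24833`, route of record `route-HodgeConjecture-HCCMUnconditional`; PROOF lane (theorems only: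
no `def`, no `instance`, no `notation`, no named fact, no `sorry`), `--supports stmt-HodgeConjecture-24833 --as helper`; count-neutral.  §L (lead K2E3-p12 (g4)): the U-side
twin at `N = 2` of ★ S2b `K2E3GL2RegularNilpotentOrbitStructure.exists_units_conj_nilp_one_eq` (`𝒩(𝔤𝔩₂) ∖ {0} = Ad(GL₂)·E₁₂`): for the socket (L-B_U)′ (U12 :373) at `N = 2`
one needs the set-theoretic structure of the nilpotent cone of `𝔲(σ, J)` for an ISOTROPIC hermitian plane `J`; every such plane is congruent to the hyperbolic model
`J₀ = !![0,1;1,0]`, treated here (the anisotropic plane has `𝒩 = {0}`, ★ p856833).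

THE MATHEMATICS (`E` a field with an involution `σ`, `F = E^σ`; `𝔲 = lieOfForm σ J₀ = {X | ᵗ(σX)·J₀ + J₀·X = 0}`, `U = unitaryGroupOfForm σ J₀ ≤ GL₂(E)`).
* §1 `𝔲(σ,J₀) = {!![a, b; c, −σa] : σb = −b, σc = −c}` (`mem_lieOfForm_hyperbolic_iff`); the model nilpotents `b·E₁₂ = !![0,b;0,0]` with `b` SKEW lie in `𝔲`.
* §2 three families in `U(σ,J₀)`: the lower unipotents `!![1,0;r,1]` (`σr = −r`), the torus `diag(e, (σe)⁻¹)` (`e ≠ 0`), the Weyl element `w = J₀`.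
* §3 NORMAL FORM: a non-zero `X ∈ 𝔲` with `X² = 0` is `u·(b E₁₂)·u⁻¹` for some `u ∈ U`, `b ≠ 0` skew — explicitly: `X = !![a,b;c,−a]` with `σa = a`, `a² + bc = 0`; if `b ≠ 0`
  then `u = !![1,0;−a∕b,1]` works WITH THE SAME `b`; if `b = 0` then `a = 0`, `X = c·E₂₁` and `u = w` gives `X = w·(cE₁₂)·w⁻¹`.  (No Witt theorem is needed.)
* §4 ORBIT PARAMETER: `b E₁₂` and `b′E₁₂` (`b ≠ 0`) are `U`-conjugate iff `b′ = e·σe·b` for some `e ≠ 0` (⇐ the torus; ⇒ a conjugator fixes the line `⟨e₁⟩ = ker`, so it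
  is upper triangular `!![p, q; 0, (σp)⁻¹]` in `U`, and `b′ = N(p)·b`): **the non-zero nilpotent orbits of `𝔲(1,1)` are the classes of `F^{×,skew-scaled} ∕ N_{E∕F}(Eˣ)`** —
  two orbits over a local field [Rogawski1990 §8.1; Harish-Chandra 1999 §3].

HONEST LABEL: HC_CM is proved only modulo the 7 printed citations (2 remaining named inputs: hLiu418 = stmt-HodgeConjecture-24832, h413 = stmt-HodgeConjecture-24833) until rung 0
closes; (L-B_U)′ is NOT proved here; count-neutral structural input for §L.

## References
* [Rogawski1990] J. D. Rogawski, *Automorphic Representations of Unitary Groups in Three Variables*, Ann. of Math. Stud. 123 (1990) — §8.1 p. 112 (nilpotent orbits, `U(2)`∕`U(1,1)`).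
* [HarishChandra1999AdmissibleDistributions] Harish-Chandra (notes by DeBacker–Sally), *Admissible Invariant Distributions on Reductive p-adic Groups*, ULECT 16 (1999) — §3 pp. 8–10.
* [PlatonovRapinchuk1994] V. Platonov, A. Rapinchuk, *Algebraic Groups and Number Theory* (1994) — §2.3 (unitary groups of hermitian forms; the hyperbolic plane).
-/

set_option autoImplicit false
set_option linter.dupNamespace false

noncomputable section

namespace Summit.HodgeConjecture.HodgeConjecture.Cruxes.H413.K2E3U11RegularNilpotentOrbits

open scoped Matrix MatrixGroups
open Literature.NumberTheory.Automorphic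
open Summit.HodgeConjecture.HodgeConjecture.Cruxes.H413.K2E3LieUnitary (lieOfForm mem_lieOfForm_iff conj_mem_lieOfForm)

variable {E : Type*} [Field E] (σ : E →+* E)

/-! ## §1 The Lie algebra of the hyperbolic plane -/

/-- **`𝔲(σ, J₀)` for `J₀ = !![0,1;1,0]`**: `X ∈ 𝔲 ↔ σX₁₀ = −X₁₀ ∧ σX₀₀ = −X₁₁ ∧ σX₁₁ = −X₀₀ ∧ σX₀₁ = −X₀₁` (the four entries of `ᵗ(σX)·J₀ + J₀·X = 0`).
[cite: Knapp2002, I §1] [cite: PlatonovRapinchuk1994, §2.3] -/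
theorem mem_lieOfForm_hyperbolic_iff (X : Matrix (Fin 2) (Fin 2) E) :
    X ∈ lieOfForm σ !![(0 : E), 1; 1, 0] ↔ σ (X 1 0) = -X 1 0 ∧ σ (X 0 0) = -X 1 1 ∧ σ (X 1 1) = -X 0 0 ∧ σ (X 0 1) = -X 0 1 := by
  rw [mem_lieOfForm_iff, ← Matrix.ext_iff]
  simp only [Fin.forall_fin_two, Matrix.add_apply, Matrix.mul_apply, Fin.sum_univ_two, Matrix.transpose_apply, Matrix.map_apply, Matrix.of_apply,
    Matrix.cons_val', Matrix.cons_val_zero, Matrix.cons_val_one, Matrix.empty_val', Matrix.cons_val_fin_one, Matrix.zero_apply, Fin.isValue,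
    mul_one, mul_zero, one_mul, zero_mul, add_zero, zero_add]
  constructor
  · rintro ⟨⟨h00, h01⟩, h10, h11⟩
    exact ⟨by linear_combination h00, by linear_combination h01, by linear_combination h10, by linear_combination h11⟩
  · rintro ⟨h1, h2, h3, h4⟩
    exact ⟨⟨by linear_combination h1, by linear_combination h2⟩, by linear_combination h3, by linear_combination h4⟩

/-- The model nilpotent `b·E₁₂ = !![0,b;0,0]` lies in `𝔲(σ,J₀)` iff `b` is skew. [cite: Rogawski1990, §8.1 p. 112] -/
theorem upperNilp_mem_lieOfForm_hyperbolic_iff (b : E) : (!![0, b; 0, 0] : Matrix (Fin 2) (Fin 2) E) ∈ lieOfForm σ !![(0 : E), 1; 1, 0] ↔ σ b = -b := by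
  rw [mem_lieOfForm_hyperbolic_iff]
  simp [map_zero]

/-! ## §2 Three families of elements of `U(σ, J₀)` -/

/-- The lower unipotent `!![1,0;r,1]` as an element of `GL₂(E)`. -/
private theorem det_lowerUnip_ne_zero (r : E) : (!![(1 : E), 0; r, 1] : Matrix (Fin 2) (Fin 2) E).det ≠ 0 := by
  rw [Matrix.det_fin_two_of]; simp

/-- **Lower unipotents**: `!![1,0;r,1] ∈ U(σ,J₀)` for `σr = −r`. [cite: PlatonovRapinchuk1994, §2.3] -/
theorem lowerUnip_mem_unitaryGroupOfForm {r : E} (hr : σ r = -r) :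
    Matrix.GeneralLinearGroup.mkOfDetNeZero !![(1 : E), 0; r, 1] (det_lowerUnip_ne_zero r) ∈ unitaryGroupOfForm σ !![(0 : E), 1; 1, 0] := by
  rw [mem_unitaryGroupOfForm_iff]
  change ((!![(1 : E), 0; r, 1] : Matrix (Fin 2) (Fin 2) E).map σ)ᵀ * !![(0 : E), 1; 1, 0] * !![(1 : E), 0; r, 1] = !![(0 : E), 1; 1, 0]
  ext i j
  fin_cases i <;> fin_cases j <;>
    simp [Matrix.mul_apply, Fin.sum_univ_two, Matrix.map_apply, hr]

/-- The torus element `diag(e, (σe)⁻¹)` has non-zero determinant for `e ≠ 0`. -/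
private theorem det_torus_ne_zero {e : E} (he : e ≠ 0) (hσe : σ e ≠ 0) : (!![e, 0; 0, (σ e)⁻¹] : Matrix (Fin 2) (Fin 2) E).det ≠ 0 := by
  rw [Matrix.det_fin_two_of]; simp [he, hσe]

/-- **The torus**: `diag(e, (σe)⁻¹) ∈ U(σ,J₀)` for `e ≠ 0` (`σ` an involution). [cite: PlatonovRapinchuk1994, §2.3] -/
theorem torus_mem_unitaryGroupOfForm (hσ : ∀ x, σ (σ x) = x) {e : E} (he : e ≠ 0) :
    Matrix.GeneralLinearGroup.mkOfDetNeZero !![e, 0; 0, (σ e)⁻¹] (det_torus_ne_zero σ he ((map_ne_zero σ).2 he)) ∈ unitaryGroupOfForm σ !![(0 : E), 1; 1, 0] := by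
  have hσe : σ e ≠ 0 := (map_ne_zero σ).2 he
  rw [mem_unitaryGroupOfForm_iff]
  change ((!![e, 0; 0, (σ e)⁻¹] : Matrix (Fin 2) (Fin 2) E).map σ)ᵀ * !![(0 : E), 1; 1, 0] * !![e, 0; 0, (σ e)⁻¹] = !![(0 : E), 1; 1, 0]
  ext i j
  fin_cases i <;> fin_cases j <;>
    simp [Matrix.mul_apply, Fin.sum_univ_two, Matrix.map_apply, map_inv₀, hσ, he, hσe]

/-- The Weyl element `w = J₀` has non-zero determinant. -/
private theorem det_weyl_ne_zero : (!![(0 : E), 1; 1, 0] : Matrix (Fin 2) (Fin 2) E).det ≠ 0 := by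
  rw [Matrix.det_fin_two_of]; simp

/-- **The Weyl element**: `w = !![0,1;1,0] ∈ U(σ,J₀)`. [cite: PlatonovRapinchuk1994, §2.3] -/
theorem weyl_mem_unitaryGroupOfForm :
    Matrix.GeneralLinearGroup.mkOfDetNeZero !![(0 : E), 1; 1, 0] det_weyl_ne_zero ∈ unitaryGroupOfForm σ !![(0 : E), 1; 1, 0] := by
  rw [mem_unitaryGroupOfForm_iff]
  change ((!![(0 : E), 1; 1, 0] : Matrix (Fin 2) (Fin 2) E).map σ)ᵀ * !![(0 : E), 1; 1, 0] * !![(0 : E), 1; 1, 0] = !![(0 : E), 1; 1, 0]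
  ext i j
  fin_cases i <;> fin_cases j <;>
    simp [Matrix.mul_apply, Fin.sum_univ_two, Matrix.map_apply]

/-! ## §3 Normal form: every non-zero nilpotent of `𝔲(σ,J₀)` is `U`-conjugate to a skew multiple of `E₁₂` -/

/-- Conjugation identity in `GL₂(E)`: `u·Y·u⁻¹ = X ↔ u·Y = X·u`. [folklore] -/
theorem conj_eq_iff (u : GL (Fin 2) E) (X Y : Matrix (Fin 2) (Fin 2) E) :
    (u : Matrix (Fin 2) (Fin 2) E) * Y * ((u⁻¹ : GL (Fin 2) E) : Matrix (Fin 2) (Fin 2) E) = X ↔ (u : Matrix (Fin 2) (Fin 2) E) * Y = X * (u : Matrix (Fin 2) (Fin 2) E) :=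
  Units.mul_inv_eq_iff_eq_mul u

/-- **NORMAL FORM OF THE NON-ZERO NILPOTENTS OF `𝔲(1,1)`.**  For an involution `σ` of the field `E` and `X ∈ 𝔲(σ, J₀)` with `X² = 0`, `X ≠ 0`: there are `u ∈ U(σ, J₀)` and a
SKEW `b ≠ 0` with `X = u·(b E₁₂)·u⁻¹`.  Explicitly `X = !![a, b; c, −a]` with `σa = a`, `a² + bc = 0`: for `b ≠ 0` the lower unipotent `u = !![1,0;−a∕b,1]` does it with the same `b`;
for `b = 0` (then `a = 0`, `X = cE₂₁`) the Weyl element does it with `b := c`.  U-side twin of ★ S2b `exists_units_conj_nilp_one_eq`.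
[cite: Rogawski1990, §8.1 p. 112] [cite: HarishChandra1999AdmissibleDistributions, §3 pp. 8–10] -/
theorem exists_unitary_conj_upperNilp_eq {X : Matrix (Fin 2) (Fin 2) E} (hX : X ∈ lieOfForm σ !![(0 : E), 1; 1, 0])
    (hsq : X * X = 0) (h0 : X ≠ 0) :
    ∃ u ∈ unitaryGroupOfForm σ !![(0 : E), 1; 1, 0], ∃ b : E, σ b = -b ∧ b ≠ 0 ∧
      (u : Matrix (Fin 2) (Fin 2) E) * !![0, b; 0, 0] * ((u⁻¹ : GL (Fin 2) E) : Matrix (Fin 2) (Fin 2) E) = X := by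
  obtain ⟨h10, h00, h11, h01⟩ := (mem_lieOfForm_hyperbolic_iff σ X).1 hX
  -- `X² = 0`: trace `0` and the `(0,0)` entry of `X²`
  have hsq00 := congrFun (congrFun hsq 0) 0
  have hsq01 := congrFun (congrFun hsq 0) 1
  have hsq10 := congrFun (congrFun hsq 1) 0
  simp only [Matrix.mul_apply, Fin.sum_univ_two, Matrix.zero_apply, Fin.isValue] at hsq00 hsq01 hsq10
  by_cases hb : X 0 1 = 0
  · -- `b = 0`: then `a = 0 = d`, `X = c E₂₁`, conjugate by `w`
    have ha : X 0 0 = 0 := by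
      have h : X 0 0 * X 0 0 = 0 := by rw [hb, zero_mul, add_zero] at hsq00; exact hsq00
      exact mul_self_eq_zero.1 h
    have hd : X 1 1 = 0 := by
      have h : X 1 1 * X 1 1 = 0 := by
        have h' := congrFun (congrFun hsq 1) 1
        simp only [Matrix.mul_apply, Fin.sum_univ_two, Matrix.zero_apply, Fin.isValue, hb, mul_zero, zero_add] at h'
        exact h'
      exact mul_self_eq_zero.1 h
    have hc : X 1 0 ≠ 0 := by
      intro hc
      apply h0
      ext i j; fin_cases i <;> fin_cases j <;> simp [ha, hb, hc, hd]
    refine ⟨_, weyl_mem_unitaryGroupOfForm σ, X 1 0, h10, hc, ?_⟩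
    rw [conj_eq_iff]
    change (!![(0 : E), 1; 1, 0] : Matrix (Fin 2) (Fin 2) E) * !![0, X 1 0; 0, 0] = X * !![(0 : E), 1; 1, 0]
    ext i j
    fin_cases i <;> fin_cases j
    · simp [Matrix.mul_apply, Fin.sum_univ_two, ha, hb]
    · simp [Matrix.mul_apply, Fin.sum_univ_two, ha, hb]
    · simp [Matrix.mul_apply, Fin.sum_univ_two, hd]
    · simp [Matrix.mul_apply, Fin.sum_univ_two, hd]
  · -- `b ≠ 0`: trace zero from `(X²)₀₁ = b·(a + d) = 0`, then the lower unipotent `!![1,0;−a/b,1]`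
    have hd : X 1 1 = -X 0 0 := by
      have h : X 0 1 * (X 0 0 + X 1 1) = 0 := by linear_combination hsq01
      have h' := (mul_eq_zero.1 h).resolve_left hb
      linear_combination h'
    have ha : σ (X 0 0) = X 0 0 := by rw [h00, hd, neg_neg]
    have hr : σ (-(X 0 0 / X 0 1)) = -(-(X 0 0 / X 0 1)) := by
      rw [map_neg, map_div₀, ha, h01, div_neg]
    refine ⟨_, lowerUnip_mem_unitaryGroupOfForm σ hr, X 0 1, h01, hb, ?_⟩
    rw [conj_eq_iff]
    change (!![(1 : E), 0; -(X 0 0 / X 0 1), 1] : Matrix (Fin 2) (Fin 2) E) * !![0, X 0 1; 0, 0] = X * !![(1 : E), 0; -(X 0 0 / X 0 1), 1]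
    have h10' : X 1 0 = -(X 0 0 * X 0 0) / X 0 1 := by rw [eq_div_iff hb]; linear_combination hsq00
    ext i j
    fin_cases i <;> fin_cases j
    · simp [Matrix.mul_apply, Fin.sum_univ_two]
      rw [← mul_div_assoc, mul_div_cancel_left₀ _ hb, add_neg_cancel]
    · simp [Matrix.mul_apply, Fin.sum_univ_two]
    · simp [Matrix.mul_apply, Fin.sum_univ_two, hd]
      rw [h10']; ring
    · simp [Matrix.mul_apply, Fin.sum_univ_two, hd]
      exact div_mul_cancel₀ _ hb

/-! ## §4 The orbit parameter: `bE₁₂ ~ b′E₁₂ ↔ b′ ∈ N_{E∕F}(Eˣ)·b` -/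

/-- **THE ORBIT PARAMETER.**  For `σ` an involution and `b ≠ 0`: `b E₁₂` and `b′ E₁₂` are `U(σ,J₀)`-conjugate iff `b′ = e·σe·b` for some `e ≠ 0`.  (⇐ the torus
`diag(e,(σe)⁻¹)`; ⇒ a conjugator `u` has `u₁₀ = 0` (it fixes `ker = ⟨e₁⟩`), unitarity forces `u₁₁ = (σu₀₀)⁻¹`, and then `b′ = N(u₀₀)·b`.)  Hence the non-zero nilpotent
`U(1,1)`-orbits are parametrised by the skew line modulo `N_{E∕F}(Eˣ)` — two orbits over a non-archimedean local field. [cite: Rogawski1990, §8.1 p. 112]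
[cite: HarishChandra1999AdmissibleDistributions, §3 pp. 8–10] -/
theorem unitary_conj_upperNilp_iff (hσ : ∀ x, σ (σ x) = x) {b : E} (hb : b ≠ 0) (b' : E) :
    (∃ u ∈ unitaryGroupOfForm σ !![(0 : E), 1; 1, 0],
        (u : Matrix (Fin 2) (Fin 2) E) * !![0, b; 0, 0] * ((u⁻¹ : GL (Fin 2) E) : Matrix (Fin 2) (Fin 2) E) = !![0, b'; 0, 0]) ↔
      ∃ e : E, e ≠ 0 ∧ e * σ e * b = b' := by
  constructor
  · rintro ⟨u, hu, hconj⟩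
    rw [conj_eq_iff] at hconj
    rw [mem_unitaryGroupOfForm_iff] at hu
    -- entries of `u·(bE₁₂) = (b′E₁₂)·u`
    have e10 := congrFun (congrFun hconj 1) 1
    have e00 := congrFun (congrFun hconj 0) 1
    simp only [Matrix.mul_apply, Fin.sum_univ_two, Matrix.of_apply, Matrix.cons_val', Matrix.cons_val_zero, Matrix.cons_val_one, Matrix.empty_val',
      Matrix.cons_val_fin_one, Fin.isValue, mul_zero, zero_mul, add_zero, zero_add] at e10 e00
    -- `e10 : u₁₀ · b = 0`, so `u₁₀ = 0`; `e00 : u₀₀ · b = b′ · u₁₁`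
    have hu10 : (u : Matrix (Fin 2) (Fin 2) E) 1 0 = 0 := by
      rcases mul_eq_zero.1 e10 with h | h
      · exact h
      · exact absurd h hb
    -- unitarity, entry `(0,1)`: `σu₀₀ · u₁₁ + σu₁₀ · u₀₁ = 1`
    have hU := congrFun (congrFun hu 0) 1
    simp only [Matrix.mul_apply, Fin.sum_univ_two, Matrix.transpose_apply, Matrix.map_apply, Matrix.of_apply, Matrix.cons_val', Matrix.cons_val_zero,
      Matrix.cons_val_one, Matrix.empty_val', Matrix.cons_val_fin_one, Fin.isValue, mul_zero, zero_mul, add_zero, zero_add, mul_one, hu10, map_zero] at hU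
    -- `hU : σ u₀₀ * u₁₁ = 1`
    have hp0 : (u : Matrix (Fin 2) (Fin 2) E) 0 0 ≠ 0 := by
      intro h; rw [h, map_zero, zero_mul] at hU; exact zero_ne_one hU
    refine ⟨(u : Matrix (Fin 2) (Fin 2) E) 0 0, hp0, ?_⟩
    have hσp0 : σ ((u : Matrix (Fin 2) (Fin 2) E) 0 0) ≠ 0 := (map_ne_zero σ).2 hp0
    have hu11 : (u : Matrix (Fin 2) (Fin 2) E) 1 1 = (σ ((u : Matrix (Fin 2) (Fin 2) E) 0 0))⁻¹ := by
      field_simp; linear_combination hU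
    rw [hu11] at e00
    field_simp at e00
    linear_combination e00
  · rintro ⟨e, he, rfl⟩
    refine ⟨_, torus_mem_unitaryGroupOfForm σ hσ he, ?_⟩
    have hσe : σ e ≠ 0 := (map_ne_zero σ).2 he
    rw [conj_eq_iff]
    change (!![e, 0; 0, (σ e)⁻¹] : Matrix (Fin 2) (Fin 2) E) * !![0, b; 0, 0] = !![0, e * σ e * b; 0, 0] * !![e, 0; 0, (σ e)⁻¹]
    ext i j
    fin_cases i <;> fin_cases j
    · simp [Matrix.mul_apply, Fin.sum_univ_two]
    · simp [Matrix.mul_apply, Fin.sum_univ_two]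
      rw [eq_mul_inv_iff_mul_eq₀ hσe]; ring
    · simp [Matrix.mul_apply, Fin.sum_univ_two]
    · simp [Matrix.mul_apply, Fin.sum_univ_two]

end Summit.HodgeConjecture.HodgeConjecture.Cruxes.H413.K2E3U11RegularNilpotentOrbits

end
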